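import Literature.NumberTheory.Automorphic.GodementJacquetZetaHeckeShift
import Literature.NumberTheory.Automorphic.GodementJacquetAtomsDecomp
import HarnessLib

/-!
# Rationality of the local Godement–Jacquet zeta integrals at a fixed level, with a common
denominator (Godement–Jacquet (1972), Thm. 3.3 (2), elementary proof)

Topic `NumberTheory/Automorphic`. Fifth support file of the discharge of
`GodementJacquet1972_local_existsUnique_hasGJLFactor` (`GodementJacquetLocal`), on top of
`GodementJacquetZetaHeckeShift` (the Hecke shift of the zeta integrals and the Cayley–Hamilton step)
and `GodementJacquetAtoms*` (congruence classes of matrices, their refinement and counting).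

* `IsLaurentTimes q s₀ P Z` (**definition**): on the half-plane `re s > s₀`, `Z(s) · P(q^{-s})` is a
  Laurent polynomial in `q^{-s}`; closure under sums, scalars, polynomial multiples, shifts, and
  **the Cayley–Hamilton step** `isLaurentTimes_of_sub_eq` (if `y_i = z_i - x^d ∑_k z_k A_{ki}` and the
  `y_k` are Laurent times `P`, the `z_i` are Laurent times `det(1 - T^d A) P`).
* Test functions and substitutions: indicator functions of level sets / congruence classes of integral
  matrices are Schwartz–Bruhat (`indicator_mem_schwartzBruhat_of_level`,
  `indicator_gjClass_mem_schwartzBruhat`), translates (`schwartzBruhat_translate_right`,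
  `schwartzBruhat_translate_two_sided`), the two-sided twist `gjLocalZeta_comp_conj`, linearity, constant
  determinant factors, powers of `q^{-s}`.
* The level-`K_m` set-up: `V^{K_m}` is `GL_n(𝒪)`-stable, the Hecke operators in a basis of `V^{K_m}`
  (`heckeOperator_basis_eq_sum`, `gjLocalZeta_heckeOperator_basis`), twisting class indicators
  (`isLaurentTimes_indicator_gjClass_twist`), decomposition of class functions
  (`isLaurentTimes_classFun`), fully pinned classes (`isLaurentTimes_fullPins`).
* `isLaurentTimes_gapAtom` (**the gap atom**): Hecke shift + counting + Cayley–Hamilton for one pinned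
  class under the gap condition; `GJClaim` (**definition**, the induction claim at rank `c`),
  `gjClaim_step`, `gjClaim_all` (downward induction on the number of pins).
* `exists_poly_isLaurentTimes_classFun` (**main theorem**): ONE polynomial `P₀`, `P₀(0) = 1`, such that
  `P₀(q^{-s}) Z(f, s, ⟨ρ(·) w, ψ⟩)` is a Laurent polynomial in `q^{-s}` on the half-plane of
  convergence for every class function `f` at level `K_m` supported in `M_n(𝒪)`, every `w ∈ V^{K_m}`
  and every `ψ` in a `GL_n(𝒪)`-stable family — the level-`K_m` form of Godement–Jacquet (1972),
  Thm. 3.3 (2) (rationality with common denominator), proved here by an elementary Hecke-shift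
  induction instead of the Kirillov-model / asymptotics argument of the source.

## References

* R. Godement, H. Jacquet, *Zeta functions of simple algebras*, LNM 260 (1972), §3, Thm. 3.3
  [GodementJacquet1972].
* H. Jacquet, *Principal `L`-functions of the linear group*, Proc. Sympos. Pure Math. 33 (1979),
  Part 2, §1, Prop. (1.2) [JacquetCorvallis1979].
-/

set_option autoImplicit false

noncomputable section

open scoped MatrixGroups Matrix NNReal
open Matrix ValuativeRel Polynomial

namespace Literature.NumberTheory.Automorphic

/-! ### Laurent polynomials in `q^{-s}` times a fixed polynomial -/

section Laurent

/-- **`Z · P` is a Laurent polynomial in `q^{-s}` for `re s > s₀`**: there are a polynomial `p` and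
`k ∈ ℕ` with `Z(s) P(q^{-s}) = p(q^{-s}) / (q^{-s})^k` for all `s` with `re s > s₀`. With `P` a common
denominator this is the shape "`Z(s) = R(q^{-s}) / P(q^{-s})`, `R ∈ ℂ[T, T⁻¹]`" of Godement–Jacquet (1972),
Thm. 3.3 (2), on the half-plane of absolute convergence. [folklore] -/
def IsLaurentTimes (q : ℕ) (s₀ : ℝ) (P : ℂ[X]) (Z : ℂ → ℂ) : Prop :=
  ∃ (p : ℂ[X]) (k : ℕ), ∀ s : ℂ, s₀ < s.re →
    Z s * P.eval ((q : ℂ) ^ (-s)) = p.eval ((q : ℂ) ^ (-s)) / ((q : ℂ) ^ (-s)) ^ k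

variable {q : ℕ} {s₀ : ℝ}

/-- `q^{-s} ≠ 0` for `q ≠ 0`. [folklore] -/
theorem qpow_ne_zero (hq : q ≠ 0) (s : ℂ) : (q : ℂ) ^ (-s) ≠ 0 :=
  Complex.cpow_ne_zero_iff.2 (Or.inl (Nat.cast_ne_zero.2 hq))

/-- The zero function is Laurent times any `P`. [folklore] -/
theorem IsLaurentTimes.zero (P : ℂ[X]) : IsLaurentTimes q s₀ P 0 :=
  ⟨0, 0, fun s _ => by simp⟩

/-- Transport along an identity on the half-plane. [folklore] -/
theorem IsLaurentTimes.congr {P : ℂ[X]} {Z Z' : ℂ → ℂ} (h : IsLaurentTimes q s₀ P Z)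
    (hZ : ∀ s : ℂ, s₀ < s.re → Z' s = Z s) : IsLaurentTimes q s₀ P Z' := by
  obtain ⟨p, k, hp⟩ := h
  exact ⟨p, k, fun s hs => by rw [hZ s hs, hp s hs]⟩

/-- Sums. [folklore] -/
theorem IsLaurentTimes.add (hq : q ≠ 0) {P : ℂ[X]} {Z Z' : ℂ → ℂ} (h : IsLaurentTimes q s₀ P Z)
    (h' : IsLaurentTimes q s₀ P Z') : IsLaurentTimes q s₀ P (Z + Z') := by
  obtain ⟨p, k, hp⟩ := h
  obtain ⟨p', k', hp'⟩ := h'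
  refine ⟨p * X ^ k' + p' * X ^ k, k + k', fun s hs => ?_⟩
  have hx : ((q : ℂ) ^ (-s)) ≠ 0 := qpow_ne_zero hq s
  rw [Pi.add_apply, add_mul, hp s hs, hp' s hs, eval_add, eval_mul, eval_mul, eval_pow, eval_pow,
    eval_X]
  field_simp
  ring

/-- Scalar multiples. [folklore] -/
theorem IsLaurentTimes.const_mul {P : ℂ[X]} {Z : ℂ → ℂ} (h : IsLaurentTimes q s₀ P Z) (c : ℂ) :
    IsLaurentTimes q s₀ P (fun s => c * Z s) := by
  obtain ⟨p, k, hp⟩ := h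
  refine ⟨Polynomial.C c * p, k, fun s hs => ?_⟩
  rw [mul_assoc, hp s hs, eval_mul, eval_C, mul_div_assoc]

/-- Finite sums. [folklore] -/
theorem IsLaurentTimes.sum (hq : q ≠ 0) {P : ℂ[X]} {ι : Type*} (t : Finset ι) {Z : ι → ℂ → ℂ}
    (h : ∀ i ∈ t, IsLaurentTimes q s₀ P (Z i)) :
    IsLaurentTimes q s₀ P (fun s => ∑ i ∈ t, Z i s) := by
  classical
  induction t using Finset.induction_on with
  | empty =>
    refine (IsLaurentTimes.zero (q := q) (s₀ := s₀) P).congr fun s _ => ?_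
    simp
  | @insert j t hj ih =>
    have h1 := (h j (Finset.mem_insert_self j t)).add hq (ih fun i hi => h i (Finset.mem_insert_of_mem hi))
    refine h1.congr fun s _ => ?_
    rw [Finset.sum_insert hj]
    rfl

/-- Multiplying the denominator by a polynomial. [folklore] -/
theorem IsLaurentTimes.mul_poly {P : ℂ[X]} {Z : ℂ → ℂ} (h : IsLaurentTimes q s₀ P Z) (Q : ℂ[X]) :
    IsLaurentTimes q s₀ (P * Q) Z := by
  obtain ⟨p, k, hp⟩ := h
  refine ⟨p * Q, k, fun s hs => ?_⟩
  rw [eval_mul, ← mul_assoc, hp s hs, eval_mul, div_mul_eq_mul_div]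

/-- Multiplying the denominator by a polynomial on the left. [folklore] -/
theorem IsLaurentTimes.poly_mul {P : ℂ[X]} {Z : ℂ → ℂ} (h : IsLaurentTimes q s₀ P Z) (Q : ℂ[X]) :
    IsLaurentTimes q s₀ (Q * P) Z := by
  rw [mul_comm]; exact h.mul_poly Q

/-- Multiplying the function by a natural power of `q^{-s}`. [folklore] -/
theorem IsLaurentTimes.qpow_pow_mul {P : ℂ[X]} {Z : ℂ → ℂ} (h : IsLaurentTimes q s₀ P Z) (j : ℕ) :
    IsLaurentTimes q s₀ P (fun s => ((q : ℂ) ^ (-s)) ^ j * Z s) := by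
  obtain ⟨p, k, hp⟩ := h
  refine ⟨X ^ j * p, k, fun s hs => ?_⟩
  rw [mul_assoc, hp s hs, eval_mul, eval_pow, eval_X, mul_div_assoc]

/-- Multiplying the function by a negative power of `q^{-s}`. [folklore] -/
theorem IsLaurentTimes.qpow_pow_inv_mul {P : ℂ[X]} {Z : ℂ → ℂ} (h : IsLaurentTimes q s₀ P Z) (j : ℕ) :
    IsLaurentTimes q s₀ P (fun s => (((q : ℂ) ^ (-s)) ^ j)⁻¹ * Z s) := by
  obtain ⟨p, k, hp⟩ := h
  refine ⟨p, k + j, fun s hs => ?_⟩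
  rw [mul_assoc, hp s hs, pow_add, ← div_div, div_eq_inv_mul (p.eval _ / _)]

/-- Multiplying the function by an integer power of `q^{-s}`. [folklore] -/
theorem IsLaurentTimes.qpow_zpow_mul {P : ℂ[X]} {Z : ℂ → ℂ} (h : IsLaurentTimes q s₀ P Z)
    (j : ℤ) : IsLaurentTimes q s₀ P (fun s => ((q : ℂ) ^ (-s)) ^ j * Z s) := by
  obtain ⟨j', rfl | rfl⟩ := j.eq_nat_or_neg
  · simpa only [zpow_natCast] using h.qpow_pow_mul j'
  · refine (h.qpow_pow_inv_mul j').congr fun s _ => ?_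
    rw [_root_.zpow_neg, zpow_natCast]

/-- Multiplying the function by a polynomial in `q^{-s}`. [folklore] -/
theorem IsLaurentTimes.eval_mul {P : ℂ[X]} {Z : ℂ → ℂ} (h : IsLaurentTimes q s₀ P Z) (Q : ℂ[X]) :
    IsLaurentTimes q s₀ P (fun s => Q.eval ((q : ℂ) ^ (-s)) * Z s) := by
  obtain ⟨p, k, hp⟩ := h
  refine ⟨Q * p, k, fun s hs => ?_⟩
  rw [mul_assoc, hp s hs, Polynomial.eval_mul, mul_div_assoc]

/-- **The Cayley–Hamilton step.** Let `A` be a square matrix, `d ∈ ℕ`, and `z, y` families of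
functions with `y_i(s) = z_i(s) - x^d ∑_k z_k(s) A_{ki}` (`x = q^{-s}`) on the half-plane. If every
`y_k` is Laurent times `P`, then every `z_i` is Laurent times `det(1 - T^d A) · P`:
`det(1 - x^d A) z_i = ∑_k y_k adj(1 - x^d A)_{ki}` (`det_mul_eq_sum_mul_adjugate_of_sub`) and the
determinant and adjugate entries are polynomials in `x` (`eval_det_one_sub_X_pow_smul`,
`eval_adjugate_one_sub_X_pow_smul`). [folklore] -/
theorem isLaurentTimes_of_sub_eq (hq : q ≠ 0) {ι : Type*} [Fintype ι] [DecidableEq ι]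
    (A : Matrix ι ι ℂ) (d : ℕ) {P : ℂ[X]} {z y : ι → ℂ → ℂ}
    (hy : ∀ s : ℂ, s₀ < s.re → ∀ i, y i s = z i s - ((q : ℂ) ^ (-s)) ^ d * ∑ k, z k s * A k i)
    (hL : ∀ k, IsLaurentTimes q s₀ P (y k)) (i : ι) :
    IsLaurentTimes q s₀ ((1 - (X ^ d : ℂ[X]) • A.map Polynomial.C).det * P) (z i) := by
  -- `det(1 - x^d A) z_i = ∑_k y_k adj_{ki}(x)`
  have key : ∀ s : ℂ, s₀ < s.re →
      ((1 - (X ^ d : ℂ[X]) • A.map Polynomial.C).det).eval ((q : ℂ) ^ (-s)) * z i s =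
        ∑ k, y k s * ((1 - (X ^ d : ℂ[X]) • A.map Polynomial.C).adjugate k i).eval ((q : ℂ) ^ (-s)) := by
    intro s hs
    rw [eval_det_one_sub_X_pow_smul]
    simp_rw [eval_adjugate_one_sub_X_pow_smul]
    exact det_mul_eq_sum_mul_adjugate_of_sub A (((q : ℂ) ^ (-s)) ^ d) (fun k => z k s) (fun k => y k s)
      (fun j => hy s hs j) i
  -- each summand is Laurent times `P`
  have hsum : IsLaurentTimes q s₀ P (fun s => ∑ k, y k s *
      ((1 - (X ^ d : ℂ[X]) • A.map Polynomial.C).adjugate k i).eval ((q : ℂ) ^ (-s))) := by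
    refine IsLaurentTimes.sum hq _ fun k _ => ?_
    exact ((hL k).eval_mul _).congr fun s _ => mul_comm _ _
  obtain ⟨p, k, hp⟩ := hsum
  refine ⟨p, k, fun s hs => ?_⟩
  rw [Polynomial.eval_mul, ← mul_assoc, mul_comm (z i s), key s hs]
  exact hp s hs

end Laurent

/-! ### Test functions: indicator functions of level sets and translates -/

section TestFunctions

variable {F : Type*} [Field F] [ValuativeRel F] [TopologicalSpace F] [IsNonarchimedeanLocalField F]
  {n : ℕ} {ϖ : F}

/-- The box `{Y | |Y - X| ≤ |ϖ|^N}` around a matrix is open. [folklore] -/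
theorem isOpen_setOf_valBound_sub (hϖ0 : ϖ ≠ 0) (N : ℕ) (X : Matrix (Fin n) (Fin n) F) :
    IsOpen {Y : Matrix (Fin n) (Fin n) F | ValBound (valuation F ϖ ^ N) (Y - X)} := by
  have e : {Y : Matrix (Fin n) (Fin n) F | ValBound (valuation F ϖ ^ N) (Y - X)} =
      ⋂ i : Fin n, ⋂ j : Fin n, (fun Y : Matrix (Fin n) (Fin n) F => Y i j - X i j) ⁻¹'
        {x : F | valuation F x ≤ valuation F ϖ ^ N} := by
    ext Y
    simp only [Set.mem_setOf_eq, Set.mem_iInter, Set.mem_preimage, ValBound, Matrix.sub_apply]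
  rw [e]
  refine isOpen_iInter_of_finite fun i => isOpen_iInter_of_finite fun j =>
    (DeltaCharBorel.isOpen_setOf_valuation_le (valuation_pow_ne_zero' hϖ0 N)).preimage ?_
  have hc : Continuous fun Y : Matrix (Fin n) (Fin n) F => Y i j :=
    (continuous_apply j).comp (continuous_apply i)
  exact hc.sub continuous_const

/-- **Indicator functions of level sets are Schwartz–Bruhat.** A set of integral matrices which is a
union of cosets of `ϖ^N M_n(𝒪)` is compact and open-closed, so its indicator function is locally
constant with compact support. [folklore] -/
theorem indicator_mem_schwartzBruhat_of_level (hϖ0 : ϖ ≠ 0) (N : ℕ) {C : Set (Matrix (Fin n) (Fin n) F)}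
    (hCint : ∀ X ∈ C, ValBound 1 X)
    (hCinv : ∀ X ∈ C, ∀ E : Matrix (Fin n) (Fin n) F, ValBound (valuation F ϖ ^ N) E → X + E ∈ C) :
    C.indicator (1 : Matrix (Fin n) (Fin n) F → ℂ) ∈ SchwartzBruhat (Matrix (Fin n) (Fin n) F) := by
  have hO : IsOpen C := by
    rw [isOpen_iff_mem_nhds]
    intro X hX
    refine Filter.mem_of_superset ((isOpen_setOf_valBound_sub hϖ0 N X).mem_nhds ?_) fun Y hY => ?_
    · show ValBound (valuation F ϖ ^ N) (X - X)
      rw [sub_self]; exact valBound_zero _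
    · have := hCinv X hX (Y - X) hY
      rwa [add_sub_cancel] at this
  have hCl : IsClosed C := by
    rw [← isOpen_compl_iff, isOpen_iff_mem_nhds]
    intro X hX
    refine Filter.mem_of_superset ((isOpen_setOf_valBound_sub hϖ0 N X).mem_nhds ?_) fun Y hY hYC => ?_
    · show ValBound (valuation F ϖ ^ N) (X - X)
      rw [sub_self]; exact valBound_zero _
    · apply hX
      have := hCinv Y hYC (X - Y) (by simpa using ValBound.neg hY)
      rwa [add_sub_cancel] at this
  have hK : IsCompact C :=
    (isCompact_setOf_valBound (n := n) (F := F) 1).of_isClosed_subset hCl fun X hX => hCint X hX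
  rw [mem_schwartzBruhat_iff]
  refine ⟨?_, HasCompactSupport.intro' hK hCl fun x hx => Set.indicator_of_notMem hx _⟩
  rw [IsLocallyConstant.iff_exists_open]
  intro x
  by_cases hx : x ∈ C
  · exact ⟨C, hO, hx, fun x' hx' => by rw [Set.indicator_of_mem hx', Set.indicator_of_mem hx]; rfl⟩
  · exact ⟨Cᶜ, hCl.isOpen_compl, hx, fun x' hx' => by
      rw [Set.indicator_of_notMem hx', Set.indicator_of_notMem hx]⟩

/-- **Indicator functions of congruence classes of integral matrices are Schwartz–Bruhat.**
[folklore] -/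
theorem indicator_gjClass_mem_schwartzBruhat (hϖ : IsUniformizingElement ϖ) (m N : ℕ)
    {Y : Matrix (Fin n) (Fin n) F} (hY : ValBound 1 Y) :
    (gjClass ϖ m N Y).indicator (1 : Matrix (Fin n) (Fin n) F → ℂ) ∈
      SchwartzBruhat (Matrix (Fin n) (Fin n) F) :=
  indicator_mem_schwartzBruhat_of_level hϖ.ne_zero N
    (fun _ hX => valBound_one_of_mem_gjClass hϖ.valuation_le_one hY hX)
    (fun _ hX _ hE => (add_mem_gjClass_iff hE).mpr hX)

omit [ValuativeRel F] [IsNonarchimedeanLocalField F] in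
/-- Right translates of Schwartz–Bruhat functions by invertible matrices are Schwartz–Bruhat.
[folklore] -/
theorem schwartzBruhat_translate_right [IsTopologicalRing F] {Φ : Matrix (Fin n) (Fin n) F → ℂ}
    (hΦ : Φ ∈ SchwartzBruhat (Matrix (Fin n) (Fin n) F)) (g : GL (Fin n) F) :
    (fun X => Φ (X * (g : Matrix (Fin n) (Fin n) F))) ∈ SchwartzBruhat (Matrix (Fin n) (Fin n) F) := by
  let e : Matrix (Fin n) (Fin n) F ≃ₜ Matrix (Fin n) (Fin n) F :=
    { toFun := fun X => X * (g : Matrix (Fin n) (Fin n) F)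
      invFun := fun X => X * ((g⁻¹ : GL (Fin n) F) : Matrix (Fin n) (Fin n) F)
      left_inv := fun X => by
        simp only [Matrix.mul_assoc, ← Units.val_mul, mul_inv_cancel, Units.val_one, Matrix.mul_one]
      right_inv := fun X => by
        simp only [Matrix.mul_assoc, ← Units.val_mul, inv_mul_cancel, Units.val_one, Matrix.mul_one]
      continuous_toFun := continuous_id.mul continuous_const
      continuous_invFun := continuous_id.mul continuous_const }
  exact ⟨hΦ.1.comp_continuous e.continuous, hΦ.2.comp_homeomorph e⟩

omit [ValuativeRel F] [IsNonarchimedeanLocalField F] in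
/-- Two-sided translates of Schwartz–Bruhat functions by invertible matrices are Schwartz–Bruhat.
[folklore] -/
theorem schwartzBruhat_translate_two_sided [IsTopologicalRing F] {Φ : Matrix (Fin n) (Fin n) F → ℂ}
    (hΦ : Φ ∈ SchwartzBruhat (Matrix (Fin n) (Fin n) F)) (g h : GL (Fin n) F) :
    (fun X => Φ ((g : Matrix (Fin n) (Fin n) F) * X * (h : Matrix (Fin n) (Fin n) F))) ∈
      SchwartzBruhat (Matrix (Fin n) (Fin n) F) := by
  let e : Matrix (Fin n) (Fin n) F ≃ₜ Matrix (Fin n) (Fin n) F :=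
    { toFun := fun X => (g : Matrix (Fin n) (Fin n) F) * X * (h : Matrix (Fin n) (Fin n) F)
      invFun := fun X => ((g⁻¹ : GL (Fin n) F) : Matrix (Fin n) (Fin n) F) * X *
        ((h⁻¹ : GL (Fin n) F) : Matrix (Fin n) (Fin n) F)
      left_inv := fun X => by
        simp only
        rw [← Matrix.mul_assoc, ← Matrix.mul_assoc, ← Units.val_mul, inv_mul_cancel, Units.val_one,
          Matrix.one_mul, Matrix.mul_assoc, ← Units.val_mul, mul_inv_cancel, Units.val_one, Matrix.mul_one]
      right_inv := fun X => by
        simp only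
        rw [← Matrix.mul_assoc, ← Matrix.mul_assoc, ← Units.val_mul, mul_inv_cancel, Units.val_one,
          Matrix.one_mul, Matrix.mul_assoc, ← Units.val_mul, inv_mul_cancel, Units.val_one, Matrix.mul_one]
      continuous_toFun := (continuous_const.mul continuous_id).mul continuous_const
      continuous_invFun := (continuous_const.mul continuous_id).mul continuous_const }
  exact ⟨hΦ.1.comp_continuous e.continuous, hΦ.2.comp_homeomorph e⟩

end TestFunctions

/-! ### Substitutions and linearity of the zeta integrals; powers of `q^{-s}` -/

section Substitutions

open _root_.MeasureTheory Literature.NumberTheory.GaloisRepresentations.IsNonarchimedeanLocalField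

variable {F : Type*} [Field F] [ValuativeRel F] [TopologicalSpace F] [IsNonarchimedeanLocalField F]
  {n : ℕ} [MeasurableSpace (GL (Fin n) F)] [BorelSpace (GL (Fin n) F)]
  {V : Type*} [AddCommGroup V] [Module ℂ V] (ρ : Representation ℂ (GL (Fin n) F) V)
  (μ : Measure (GL (Fin n) F))

/-- **Two-sided twist by `GL_n(𝒪)`.** For `κ, κ' ∈ GL_n(𝒪)` and a bi-invariant measure,
`Z(Φ(κ⁻¹ · κ'⁻¹), s, ⟨ρ(·) w, ψ⟩) = Z(Φ, s, ⟨ρ(·) ρ(κ') w, ψ ∘ ρ(κ)⟩)` (substitute `x = κ y κ'`,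
`|det κ| = |det κ'| = 1`). [folklore] -/
theorem gjLocalZeta_comp_conj [μ.IsMulLeftInvariant] [μ.IsMulRightInvariant]
    (Φ : Matrix (Fin n) (Fin n) F → ℂ) (ψ : Module.Dual ℂ V) (w : V) {κ κ' : GL (Fin n) F}
    (hκ : κ ∈ glInt n F) (hκ' : κ' ∈ glInt n F) (s : ℂ) :
    gjLocalZeta μ (fun X => Φ (((κ⁻¹ : GL (Fin n) F) : Matrix (Fin n) (Fin n) F) * X *
        ((κ'⁻¹ : GL (Fin n) F) : Matrix (Fin n) (Fin n) F))) (ρ.matrixCoeff ψ w) s =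
      gjLocalZeta μ Φ (ρ.matrixCoeff (ψ ∘ₗ ρ κ) (ρ κ' w)) s := by
  unfold gjLocalZeta
  conv_lhs => rw [← integral_mul_left_eq_self _ κ, ← integral_mul_right_eq_self _ κ']
  refine integral_congr_ae (Filter.Eventually.of_forall fun x => ?_)
  have e : ((κ⁻¹ : GL (Fin n) F) : Matrix (Fin n) (Fin n) F) * ((κ * (x * κ') : GL (Fin n) F) :
      Matrix (Fin n) (Fin n) F) * ((κ'⁻¹ : GL (Fin n) F) : Matrix (Fin n) (Fin n) F) =
      (x : Matrix (Fin n) (Fin n) F) := by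
    rw [← Units.val_mul, ← Units.val_mul, show κ⁻¹ * (κ * (x * κ')) * κ'⁻¹ = x by group]
  simp only [gjLocalIntegrand, Representation.matrixCoeff_apply, e, map_mul ρ, Module.End.mul_apply,
    LinearMap.comp_apply]
  rw [cpow_normAbs_det_mul, cpow_normAbs_det_mul, cpow_normAbs_det_of_mem_glInt hκ,
    cpow_normAbs_det_of_mem_glInt hκ', one_mul, mul_one]

omit [BorelSpace (GL (Fin n) F)] in
/-- The zeta integral is homogeneous in the vector of the coefficient. [folklore] -/
theorem gjLocalZeta_matrixCoeff_smul (Φ : Matrix (Fin n) (Fin n) F → ℂ) (ψ : Module.Dual ℂ V) (c : ℂ)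
    (u : V) (s : ℂ) :
    gjLocalZeta μ Φ (ρ.matrixCoeff ψ (c • u)) s = c * gjLocalZeta μ Φ (ρ.matrixCoeff ψ u) s := by
  unfold gjLocalZeta
  rw [← integral_const_mul]
  refine integral_congr_ae (Filter.Eventually.of_forall fun x => ?_)
  simp only [gjLocalIntegrand, Representation.matrixCoeff_apply, map_smul, smul_eq_mul]
  ring

omit [BorelSpace (GL (Fin n) F)] in
/-- **Pulling out a constant determinant factor**: if `|det x|^s = w` for all `x` in a set `C`, then
`Z(𝟙_C, s, f) = w ∫_C f`. [folklore] -/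
theorem gjLocalZeta_indicator_of_cpow_eq (C : Set (Matrix (Fin n) (Fin n) F)) (f : GL (Fin n) F → ℂ)
    (s w : ℂ) (hC : ∀ x : GL (Fin n) F, (x : Matrix (Fin n) (Fin n) F) ∈ C →
      (((normAbs F ((Matrix.GeneralLinearGroup.det x : Fˣ) : F) : ℝ≥0) : ℝ) : ℂ) ^ s = w) :
    gjLocalZeta μ (C.indicator (1 : Matrix (Fin n) (Fin n) F → ℂ)) f s =
      w * ∫ x, C.indicator (1 : Matrix (Fin n) (Fin n) F → ℂ) (x : Matrix (Fin n) (Fin n) F) * f x ∂μ := by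
  unfold gjLocalZeta
  rw [← integral_const_mul]
  refine integral_congr_ae (Filter.Eventually.of_forall fun x => ?_)
  simp only [gjLocalIntegrand]
  by_cases hx : (x : Matrix (Fin n) (Fin n) F) ∈ C
  · rw [hC x hx]; ring
  · rw [Set.indicator_of_notMem hx]; ring

omit [MeasurableSpace (GL (Fin n) F)] [BorelSpace (GL (Fin n) F)] in
/-- The normalised absolute value depends only on the valuation. [folklore] -/
theorem normAbs_congr {x y : F} (h : valuation F x = valuation F y) : normAbs F x = normAbs F y := by
  rw [normAbs_apply, normAbs_apply, h]

/-- `((q^k)⁻¹)^s = (q^{-s})^k` for the normalised absolute value `|ϖ| = q⁻¹`. [folklore] -/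
theorem cpow_normAbs_pow {q : ℕ} {t : ℝ≥0} (ht : t = ((q : ℝ≥0))⁻¹) (k : ℕ) (s : ℂ) :
    (((t ^ k : ℝ≥0) : ℝ) : ℂ) ^ s = ((q : ℂ) ^ (-s)) ^ k := by
  rw [ht, ← inv_natCast_pow_cpow]
  congr 1
  push_cast
  rw [inv_pow]

/-- `(q^k)^s = ((q^{-s})^k)⁻¹`. [folklore] -/
theorem natCast_pow_cpow_eq_inv {q : ℕ} (hq : q ≠ 0) (k : ℕ) (s : ℂ) :
    ((q : ℂ) ^ k) ^ s = (((q : ℂ) ^ (-s)) ^ k)⁻¹ := by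
  have h := inv_natCast_pow_cpow q k s
  have harg : ((q : ℂ) ^ k).arg ≠ Real.pi := by
    rw [show ((q : ℂ) ^ k) = ((q ^ k : ℝ) : ℂ) by push_cast; rfl, Complex.arg_ofReal_of_nonneg (by positivity)]
    exact Real.pi_pos.ne
  rw [Complex.inv_cpow _ _ harg] at h
  rw [← inv_inv (((q : ℂ) ^ k) ^ s), h]

end Substitutions

/-! ### The fixed level: `K_m`-fixed vectors, Hecke operators in a basis, twists -/

section Level

open _root_.MeasureTheory Literature.NumberTheory.GaloisRepresentations.IsNonarchimedeanLocalField

variable {F : Type*} [Field F] [ValuativeRel F] [TopologicalSpace F] [IsNonarchimedeanLocalField F]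
  {n : ℕ} [MeasurableSpace (GL (Fin n) F)] [BorelSpace (GL (Fin n) F)]
  {V : Type*} [AddCommGroup V] [Module ℂ V] (ρ : Representation ℂ (GL (Fin n) F) V)
  (μ : Measure (GL (Fin n) F)) {ϖ : F} {m : ℕ}

omit [TopologicalSpace F] [IsNonarchimedeanLocalField F] [MeasurableSpace (GL (Fin n) F)]
  [BorelSpace (GL (Fin n) F)] in
/-- **`V^{K_m}` is stable under `GL_n(𝒪)`** (the `K_m` are normal in `GL_n(𝒪)`). [folklore] -/
theorem apply_mem_fixedPoints_congruenceGL_of_mem_glInt {κ : GL (Fin n) F} (hκ : κ ∈ glInt n F) {w : V}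
    (hw : w ∈ ρ.fixedPoints (congruenceGL n (valuation F ϖ ^ m))) :
    ρ κ w ∈ ρ.fixedPoints (congruenceGL n (valuation F ϖ ^ m)) := by
  rw [Representation.mem_fixedPoints]
  intro g hg
  have hconj : κ⁻¹ * g * κ⁻¹⁻¹ ∈ congruenceGL n (valuation F ϖ ^ m) :=
    conj_mem_congruenceGL (Subgroup.inv_mem _ hκ) hg
  rw [inv_inv] at hconj
  have h := (ρ.mem_fixedPoints _ w).1 hw _ hconj
  calc ρ g (ρ κ w) = ρ (κ * (κ⁻¹ * g * κ)) w := by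
        rw [show κ * (κ⁻¹ * g * κ) = g * κ by group, map_mul, Module.End.mul_apply]
    _ = ρ κ w := by rw [map_mul, Module.End.mul_apply, h]

omit [MeasurableSpace (GL (Fin n) F)] [BorelSpace (GL (Fin n) F)] in
/-- The `K_m`-orbit of `t K_m` in `G ⧸ K_m` is finite (`K_m` is compact open). [folklore] -/
theorem finite_orbit_congruenceGL (hϖ0 : ϖ ≠ 0) (m : ℕ) (t : GL (Fin n) F) :
    (MulAction.orbit (congruenceGL n (valuation F ϖ ^ m))
      (t : GL (Fin n) F ⧸ congruenceGL n (valuation F ϖ ^ m))).Finite := by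
  haveI := isHeckeTriple_top_of_isCompact_isOpen (congruenceGL n (valuation F ϖ ^ m))
    (isCompact_congruenceGL _) (isOpen_congruenceGL (valuation_pow_ne_zero' hϖ0 m))
  exact finite_orbit_quotient _ t

omit [MeasurableSpace (GL (Fin n) F)] [BorelSpace (GL (Fin n) F)] in
/-- The Hecke operators `[K_m t K_m]` preserve `V^{K_m}`. [folklore] -/
theorem heckeOperator_mapsTo_fixedPoints (hϖ0 : ϖ ≠ 0) (t : GL (Fin n) F) :
    ∀ w ∈ ρ.fixedPoints (congruenceGL n (valuation F ϖ ^ m)),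
      heckeOperator ρ (congruenceGL n (valuation F ϖ ^ m)) t w ∈
        ρ.fixedPoints (congruenceGL n (valuation F ϖ ^ m)) :=
  fun _ hw => heckeOperator_apply_mem_fixedPoints ρ _ t hw (finite_orbit_congruenceGL hϖ0 m t)

omit [MeasurableSpace (GL (Fin n) F)] [BorelSpace (GL (Fin n) F)] in
/-- **The Hecke operator in a basis of `V^{K_m}`**: with `A` the matrix of `[K_m t K_m]|_{V^{K_m}}` in a
basis `b`, `[K_m t K_m] b_i = ∑_k A_{ki} b_k`. [folklore] -/
theorem heckeOperator_basis_eq_sum (hϖ0 : ϖ ≠ 0) (t : GL (Fin n) F) {ι : Type*} [Fintype ι]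
    [DecidableEq ι] (b : Module.Basis ι ℂ (ρ.fixedPoints (congruenceGL n (valuation F ϖ ^ m)))) (i : ι) :
    heckeOperator ρ (congruenceGL n (valuation F ϖ ^ m)) t (b i) =
      ∑ k, LinearMap.toMatrix b b ((heckeOperator ρ (congruenceGL n (valuation F ϖ ^ m)) t).restrict
        (heckeOperator_mapsTo_fixedPoints ρ hϖ0 t)) k i • ((b k : ρ.fixedPoints _) : V) := by
  set T := (heckeOperator ρ (congruenceGL n (valuation F ϖ ^ m)) t).restrict
    (heckeOperator_mapsTo_fixedPoints ρ hϖ0 t) with hT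
  have h1 : (T (b i) : V) = heckeOperator ρ (congruenceGL n (valuation F ϖ ^ m)) t (b i) := rfl
  rw [← h1, ← b.sum_repr (T (b i)), Submodule.coe_sum]
  refine Finset.sum_congr rfl fun k _ => ?_
  rw [Submodule.coe_smul, LinearMap.toMatrix_apply]

omit [BorelSpace (GL (Fin n) F)] in
/-- **Zeta integrals of `[K_m t K_m] b_i`**: `Z(Φ, s, ⟨ρ(·) [KtK] b_i, ψ⟩) = ∑_k A_{ki} Z(Φ, s, ⟨ρ(·) b_k, ψ⟩)`
(given absolute convergence). [folklore] -/
theorem gjLocalZeta_heckeOperator_basis (hϖ0 : ϖ ≠ 0) (t : GL (Fin n) F) {ι : Type*}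
    [Fintype ι] [DecidableEq ι] (b : Module.Basis ι ℂ (ρ.fixedPoints (congruenceGL n (valuation F ϖ ^ m))))
    (Φ : Matrix (Fin n) (Fin n) F → ℂ) (ψ : Module.Dual ℂ V) (s : ℂ)
    (hint : ∀ u : V, Integrable (gjLocalIntegrand Φ (ρ.matrixCoeff ψ u) s) μ) (i : ι) :
    gjLocalZeta μ Φ (ρ.matrixCoeff ψ (heckeOperator ρ (congruenceGL n (valuation F ϖ ^ m)) t (b i))) s =
      ∑ k, LinearMap.toMatrix b b ((heckeOperator ρ (congruenceGL n (valuation F ϖ ^ m)) t).restrict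
        (heckeOperator_mapsTo_fixedPoints ρ hϖ0 t)) k i *
        gjLocalZeta μ Φ (ρ.matrixCoeff ψ ((b k : ρ.fixedPoints _) : V)) s := by
  rw [heckeOperator_basis_eq_sum ρ hϖ0 t b i, gjLocalZeta_matrixCoeff_sum ρ μ _ Φ ψ _ s
    (fun k _ => hint _)]
  refine Finset.sum_congr rfl fun k _ => ?_
  rw [gjLocalZeta_matrixCoeff_smul]

omit [TopologicalSpace F] [IsNonarchimedeanLocalField F] [MeasurableSpace (GL (Fin n) F)]
  [BorelSpace (GL (Fin n) F)] in
/-- **Twisting indicator functions of classes**: for `κ, κ' ∈ GL_n(𝒪)`,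
`𝟙_{gjClass (κ Y κ')}(X) = 𝟙_{gjClass Y}(κ⁻¹ X κ'⁻¹)`. [folklore] -/
theorem indicator_gjClass_twist {N : ℕ} {Y : Matrix (Fin n) (Fin n) F} {κ κ' : GL (Fin n) F}
    (hκ : κ ∈ glInt n F) (hκ' : κ' ∈ glInt n F) (X : Matrix (Fin n) (Fin n) F) :
    (gjClass ϖ m N ((κ : Matrix (Fin n) (Fin n) F) * Y * (κ' : Matrix (Fin n) (Fin n) F))).indicator
        (1 : Matrix (Fin n) (Fin n) F → ℂ) X =
      (gjClass ϖ m N Y).indicator (1 : Matrix (Fin n) (Fin n) F → ℂ)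
        (((κ⁻¹ : GL (Fin n) F) : Matrix (Fin n) (Fin n) F) * X * ((κ'⁻¹ : GL (Fin n) F) : Matrix (Fin n) (Fin n) F)) := by
  have e : (κ : Matrix (Fin n) (Fin n) F) * (((κ⁻¹ : GL (Fin n) F) : Matrix (Fin n) (Fin n) F) * X *
      ((κ'⁻¹ : GL (Fin n) F) : Matrix (Fin n) (Fin n) F)) * (κ' : Matrix (Fin n) (Fin n) F) = X := by
    rw [← Matrix.mul_assoc, ← Matrix.mul_assoc, ← Units.val_mul, mul_inv_cancel, Units.val_one,
      Matrix.one_mul, Matrix.mul_assoc, ← Units.val_mul, inv_mul_cancel, Units.val_one, Matrix.mul_one]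
  have hiff : X ∈ gjClass ϖ m N ((κ : Matrix (Fin n) (Fin n) F) * Y * (κ' : Matrix (Fin n) (Fin n) F)) ↔
      ((κ⁻¹ : GL (Fin n) F) : Matrix (Fin n) (Fin n) F) * X * ((κ'⁻¹ : GL (Fin n) F) : Matrix (Fin n) (Fin n) F) ∈
        gjClass ϖ m N Y := by
    rw [← mul_mul_mem_gjClass_iff (Y := Y) hκ hκ', e]
  by_cases hX : X ∈ gjClass ϖ m N ((κ : Matrix (Fin n) (Fin n) F) * Y * (κ' : Matrix (Fin n) (Fin n) F))
  · rw [Set.indicator_of_mem hX, Set.indicator_of_mem (hiff.mp hX)]; rfl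
  · rw [Set.indicator_of_notMem hX, Set.indicator_of_notMem (fun h => hX (hiff.mpr h))]

/-- **Laurent-ness of class zeta integrals survives twisting by `GL_n(𝒪)`** when the family of linear
forms is `GL_n(𝒪)`-stable. [folklore] -/
theorem isLaurentTimes_indicator_gjClass_twist [μ.IsMulLeftInvariant] [μ.IsMulRightInvariant]
    {s₀ : ℝ} {P : ℂ[X]} (Ψ : Set (Module.Dual ℂ V)) (hΨ0 : ∀ ψ ∈ Ψ, ∀ κ ∈ glInt n F, ψ ∘ₗ ρ κ ∈ Ψ)
    {N : ℕ} {Y : Matrix (Fin n) (Fin n) F}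
    (h : ∀ w ∈ ρ.fixedPoints (congruenceGL n (valuation F ϖ ^ m)), ∀ ψ ∈ Ψ,
      IsLaurentTimes (residueFieldCard F) s₀ P (fun s => gjLocalZeta μ
        ((gjClass ϖ m N Y).indicator (1 : Matrix (Fin n) (Fin n) F → ℂ)) (ρ.matrixCoeff ψ w) s))
    {κ κ' : GL (Fin n) F} (hκ : κ ∈ glInt n F) (hκ' : κ' ∈ glInt n F) :
    ∀ w ∈ ρ.fixedPoints (congruenceGL n (valuation F ϖ ^ m)), ∀ ψ ∈ Ψ,
      IsLaurentTimes (residueFieldCard F) s₀ P (fun s => gjLocalZeta μ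
        ((gjClass ϖ m N ((κ : Matrix (Fin n) (Fin n) F) * Y * (κ' : Matrix (Fin n) (Fin n) F))).indicator
          (1 : Matrix (Fin n) (Fin n) F → ℂ)) (ρ.matrixCoeff ψ w) s) := by
  intro w hw ψ hψ
  refine (h (ρ κ' w) (apply_mem_fixedPoints_congruenceGL_of_mem_glInt ρ hκ' hw) (ψ ∘ₗ ρ κ) (hΨ0 ψ hψ κ hκ)).congr
    fun s _ => ?_
  rw [← gjLocalZeta_comp_conj ρ μ _ ψ w hκ hκ']
  congr 1
  funext X
  exact indicator_gjClass_twist hκ hκ' X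

omit [BorelSpace (GL (Fin n) F)] in
/-- The zeta integral is additive in the test function (difference form, given absolute
convergence). [folklore] -/
theorem gjLocalZeta_sub_left (Φ Φ' : Matrix (Fin n) (Fin n) F → ℂ) (f : GL (Fin n) F → ℂ) (s : ℂ)
    (h : Integrable (gjLocalIntegrand Φ f s) μ) (h' : Integrable (gjLocalIntegrand Φ' f s) μ) :
    gjLocalZeta μ (fun X => Φ X - Φ' X) f s = gjLocalZeta μ Φ f s - gjLocalZeta μ Φ' f s := by
  unfold gjLocalZeta
  rw [← integral_sub h h']
  refine integral_congr_ae (Filter.Eventually.of_forall fun x => ?_)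
  simp only [gjLocalIntegrand, sub_mul]

omit [BorelSpace (GL (Fin n) F)] in
/-- The zeta integral of `c · 𝟙_C` is `c` times that of `𝟙_C` (no convergence needed). [folklore] -/
theorem gjLocalZeta_indicator_const (C : Set (Matrix (Fin n) (Fin n) F)) (c : ℂ) (f : GL (Fin n) F → ℂ)
    (s : ℂ) : gjLocalZeta μ (C.indicator fun _ => c) f s =
      c * gjLocalZeta μ (C.indicator (1 : Matrix (Fin n) (Fin n) F → ℂ)) f s := by
  unfold gjLocalZeta
  rw [← integral_const_mul]
  refine integral_congr_ae (Filter.Eventually.of_forall fun x => ?_)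
  simp only [gjLocalIntegrand]
  by_cases hx : (x : Matrix (Fin n) (Fin n) F) ∈ C
  · rw [Set.indicator_of_mem hx, Set.indicator_of_mem hx, Pi.one_apply]; ring
  · rw [Set.indicator_of_notMem hx, Set.indicator_of_notMem hx]; ring

omit [MeasurableSpace (GL (Fin n) F)] [BorelSpace (GL (Fin n) F)] in
/-- `|det t⁻¹|^s = ((q^{-s})^{n - #S})⁻¹` for the shift element `t = diag(1_S, ϖ)`, `|ϖ| = q⁻¹`.
[folklore] -/
theorem cpow_normAbs_det_gjShift_inv (hϖq : normAbs F ϖ = ((residueFieldCard F : ℝ≥0))⁻¹)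
    (hϖ0 : ϖ ≠ 0) (S : Finset (Fin n)) (s : ℂ) :
    (((normAbs F ((Matrix.GeneralLinearGroup.det (gjShift hϖ0 S)⁻¹ : Fˣ) : F) : ℝ≥0) : ℝ) : ℂ) ^ s =
      ((((residueFieldCard F : ℂ)) ^ (-s)) ^ (n - S.card))⁻¹ := by
  classical
  have hq0 : (residueFieldCard F : ℝ≥0) ≠ 0 := Nat.cast_ne_zero.mpr (residueFieldCard_ne_zero F)
  have hdet : ((Matrix.GeneralLinearGroup.det (gjShift hϖ0 S)⁻¹ : Fˣ) : F) = (ϖ ^ (n - S.card))⁻¹ := by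
    rw [Matrix.GeneralLinearGroup.val_det_apply, coe_gjShift_inv, Matrix.det_diagonal, Finset.prod_ite,
      Finset.prod_const_one, one_mul, Finset.prod_const, inv_pow]
    congr 2
    rw [Finset.filter_not, Finset.filter_mem_eq_inter, Finset.univ_inter, Finset.card_sdiff_of_subset
      (Finset.subset_univ S), Finset.card_univ, Fintype.card_fin]
  rw [hdet, map_inv₀, map_pow, hϖq, inv_pow, inv_inv, ← natCast_pow_cpow_eq_inv (residueFieldCard_ne_zero F)]
  congr 1
  push_cast
  rfl

/-- **The gap atom.** Let `C = gjClass ϖ m N (gjPin ϖ S a)` with `S ≠ univ` and the gap condition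
`a_i + m ≤ N`; let `t = gjShift S`, `A` the matrix of `[K_m t K_m]` on `V^{K_m}` in a basis `b`, and
`c = #J / #(K_m t K_m / K_m)` (`J` the index set of the transversal `U_b`). If the zeta integrals of the
indicator functions of all classes modulo `ϖ^{N+1}` of twisted pinned matrices with pins `S ∪ T`,
`T ≠ ∅`, are Laurent times `P'`, then the zeta integrals of `𝟙_C` against the level-`K_m` coefficients are
Laurent times `det(1 - T^{n-#S} (c A)) · P'`: the Hecke shift (`card_mul_gjLocalZeta_heckeOperator`)
gives `Z(Φ', b_i) = c x^{n-#S} ∑_k A_{ki} Z(𝟙_C, b_k)` for the shifted function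
`Φ' = ∑_b 𝟙_C(· U_b t⁻¹)`, the difference `𝟙_C - Φ'` is a class function modulo `ϖ^{N+1}` supported
on classes with more pins (`GodementJacquetAtomsDecomp`), and the Cayley–Hamilton step applies.
[folklore] -/
theorem isLaurentTimes_gapAtom [μ.IsMulLeftInvariant] [μ.IsMulRightInvariant]
    (hϖq : normAbs F ϖ = ((residueFieldCard F : ℝ≥0))⁻¹) (hm : 1 ≤ m)
    (Ψ : Set (Module.Dual ℂ V))
    (s₀ : ℝ) (hint : ∀ Φ ∈ SchwartzBruhat (Matrix (Fin n) (Fin n) F), ∀ ψ ∈ Ψ, ∀ u : V, ∀ s : ℂ,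
      s₀ < s.re → Integrable (gjLocalIntegrand Φ (ρ.matrixCoeff ψ u) s) μ)
    {ι : Type*} [Fintype ι] [DecidableEq ι]
    (b : Module.Basis ι ℂ (ρ.fixedPoints (congruenceGL n (valuation F ϖ ^ m))))
    {S : Finset (Fin n)} {N : ℕ} {a : Fin n → ℕ} (hgap : ∀ i ∈ S, a i + m ≤ N)
    {A : Matrix ι ι ℂ}
    (hA : A = LinearMap.toMatrix b b ((heckeOperator ρ (congruenceGL n (valuation F ϖ ^ m))
      (gjShift (isUniformizingElement_of_normAbs_eq hϖq).ne_zero S)).restrict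
      (heckeOperator_mapsTo_fixedPoints ρ (isUniformizingElement_of_normAbs_eq hϖq).ne_zero _)))
    {c : ℂ}
    (hc : c = (Nat.card ({i : Fin n // i ∈ S} × {j : Fin n // j ∉ S} → 𝓀[F]) : ℂ) /
      ((finite_orbit_congruenceGL (isUniformizingElement_of_normAbs_eq hϖq).ne_zero m
        (gjShift (isUniformizingElement_of_normAbs_eq hϖq).ne_zero S)).toFinset.card : ℂ))
    {P' : ℂ[X]}
    (ih : ∀ Y : Matrix (Fin n) (Fin n) F, (∃ κ κ' : GL (Fin n) F, κ ∈ glInt n F ∧ κ' ∈ glInt n F ∧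
      ∃ T : Finset (Fin n), T.Nonempty ∧ (∀ i ∈ T, i ∉ S) ∧
        Y ∈ gjClass ϖ m (N + 1) ((κ : Matrix (Fin n) (Fin n) F) *
          gjPin ϖ (S ∪ T) (fun i => if i ∈ S then a i else N) * (κ' : Matrix (Fin n) (Fin n) F))) →
      ∀ w ∈ ρ.fixedPoints (congruenceGL n (valuation F ϖ ^ m)), ∀ ψ ∈ Ψ,
        IsLaurentTimes (residueFieldCard F) s₀ P' (fun s => gjLocalZeta μ
          ((gjClass ϖ m (N + 1) Y).indicator (1 : Matrix (Fin n) (Fin n) F → ℂ)) (ρ.matrixCoeff ψ w) s)) :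
    ∀ w ∈ ρ.fixedPoints (congruenceGL n (valuation F ϖ ^ m)), ∀ ψ ∈ Ψ,
      IsLaurentTimes (residueFieldCard F) s₀
        ((1 - (X ^ (n - S.card) : ℂ[X]) • (c • A).map Polynomial.C).det * P')
        (fun s => gjLocalZeta μ ((gjClass ϖ m N (gjPin ϖ S a)).indicator (1 : Matrix (Fin n) (Fin n) F → ℂ))
          (ρ.matrixCoeff ψ w) s) := by
  classical
  haveI := Fintype.ofFinite 𝓀[F]
  have hϖu : IsUniformizingElement ϖ := isUniformizingElement_of_normAbs_eq hϖq
  have hϖle : valuation F ϖ ≤ 1 := hϖu.valuation_le_one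
  set q : ℕ := residueFieldCard F with hqdef
  have hq : q ≠ 0 := residueFieldCard_ne_zero F
  have hKint : congruenceGL n (valuation F ϖ ^ m) ≤ glInt n F := congruenceGL_le_glInt _
  set d : ℕ := n - S.card with hd
  set C₁ : Set (Matrix (Fin n) (Fin n) F) := gjClass ϖ m N (gjPin ϖ S a) with hC₁
  set Φ : Matrix (Fin n) (Fin n) F → ℂ := C₁.indicator 1 with hΦ
  set J := {i : Fin n // i ∈ S} × {j : Fin n // j ∉ S} → 𝓀[F]
  set Φ' : Matrix (Fin n) (Fin n) F → ℂ := fun X => ∑ bJ : J,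
    C₁.indicator (1 : Matrix (Fin n) (Fin n) F → ℂ) (X * ((gjTransv hϖu hm S bJ : GL (Fin n) F) :
      Matrix (Fin n) (Fin n) F) * (((gjShift hϖu.ne_zero S)⁻¹ : GL (Fin n) F) : Matrix (Fin n) (Fin n) F)) with hΦ'
  -- Schwartz–Bruhat and invariance properties
  have hΦSB : Φ ∈ SchwartzBruhat (Matrix (Fin n) (Fin n) F) :=
    indicator_gjClass_mem_schwartzBruhat hϖu m N (valBound_one_gjPin hϖle S a)
  have hΦK : ∀ X : Matrix (Fin n) (Fin n) F, ∀ k ∈ congruenceGL n (valuation F ϖ ^ m),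
      Φ (X * (k : Matrix (Fin n) (Fin n) F)) = Φ X :=
    fun X k hk => indicator_one_congr_mem (mul_coe_mem_gjClass_iff hk)
  -- the transversal as a finite set
  set 𝒰 : Finset (GL (Fin n) F) := Finset.univ.image (gjTransv hϖu hm S) with h𝒰
  have h𝒰K : ∀ γ ∈ 𝒰, γ ∈ congruenceGL n (valuation F ϖ ^ m) := by
    intro γ hγ
    obtain ⟨bJ, -, rfl⟩ := Finset.mem_image.mp hγ
    exact gjTransv_mem_congruenceGL hϖu hm bJ
  have h𝒰card : 𝒰.card = Nat.card J := by
    rw [h𝒰, Finset.card_image_of_injective _ (gjTransv_injective hϖu hm), Finset.card_univ,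
      Nat.card_eq_fintype_card]
  have hΦ'eq : ∀ X : Matrix (Fin n) (Fin n) F, Φ' X =
      ∑ γ ∈ 𝒰, Φ (X * ((γ * (gjShift hϖu.ne_zero S)⁻¹ : GL (Fin n) F) : Matrix (Fin n) (Fin n) F)) := by
    intro X
    rw [h𝒰, Finset.sum_image fun x _ y _ h => gjTransv_injective hϖu hm h]
    refine Finset.sum_congr rfl fun bJ _ => ?_
    rw [hΦ, Units.val_mul, Matrix.mul_assoc]
  have hΦ'SB : Φ' ∈ SchwartzBruhat (Matrix (Fin n) (Fin n) F) := by
    have e : Φ' = fun X => ∑ γ ∈ 𝒰, Φ (X * ((γ * (gjShift hϖu.ne_zero S)⁻¹ : GL (Fin n) F) :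
        Matrix (Fin n) (Fin n) F)) := funext hΦ'eq
    rw [e]
    have : (fun X => ∑ γ ∈ 𝒰, Φ (X * ((γ * (gjShift hϖu.ne_zero S)⁻¹ : GL (Fin n) F) :
        Matrix (Fin n) (Fin n) F))) =
        ∑ γ ∈ 𝒰, fun X => Φ (X * ((γ * (gjShift hϖu.ne_zero S)⁻¹ : GL (Fin n) F) : Matrix (Fin n) (Fin n) F)) := by
      funext X; simp only [Finset.sum_apply]
    rw [this]
    exact Submodule.sum_mem _ fun γ _ => schwartzBruhat_translate_right hΦSB _
  -- the orbit count is positive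
  have horb : (finite_orbit_congruenceGL hϖu.ne_zero m (gjShift hϖu.ne_zero S)).toFinset.card ≠ 0 := by
    rw [Finset.card_ne_zero]
    exact ⟨((gjShift hϖu.ne_zero S : GL (Fin n) F) : GL (Fin n) F ⧸ congruenceGL n (valuation F ϖ ^ m)),
      by rw [Set.Finite.mem_toFinset]; exact MulAction.mem_orbit_self _⟩
  intro w₀ hw₀ ψ hψ
  -- the row vectors
  set z : ι → ℂ → ℂ := fun i s => gjLocalZeta μ Φ
    (ρ.matrixCoeff ψ ((b i : ρ.fixedPoints (congruenceGL n (valuation F ϖ ^ m))) : V)) s with hz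
  set y : ι → ℂ → ℂ := fun i s => z i s - gjLocalZeta μ Φ'
    (ρ.matrixCoeff ψ ((b i : ρ.fixedPoints (congruenceGL n (valuation F ϖ ^ m))) : V)) s with hy
  -- Step 1: the Hecke shift identity
  have hshift : ∀ s : ℂ, s₀ < s.re → ∀ i, gjLocalZeta μ Φ'
      (ρ.matrixCoeff ψ ((b i : ρ.fixedPoints (congruenceGL n (valuation F ϖ ^ m))) : V)) s =
      ((q : ℂ) ^ (-s)) ^ d * ∑ k, z k s * (c • A) k i := by
    intro s hs i
    have hint₁ : ∀ u : V, Integrable (gjLocalIntegrand Φ (ρ.matrixCoeff ψ u) s) μ :=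
      fun u => hint Φ hΦSB ψ hψ u s hs
    have hint₂ : Integrable (gjLocalIntegrand (fun X => Φ (X * (((gjShift hϖu.ne_zero S)⁻¹ : GL (Fin n) F) :
        Matrix (Fin n) (Fin n) F)))
        (ρ.matrixCoeff ψ ((b i : ρ.fixedPoints (congruenceGL n (valuation F ϖ ^ m))) : V)) s) μ :=
      hint _ (schwartzBruhat_translate_right hΦSB _) ψ hψ _ s hs
    have hF1 := card_mul_gjLocalZeta_heckeOperator ρ μ hKint hΦK ψ (b i).2
      (finite_orbit_congruenceGL hϖu.ne_zero m (gjShift hϖu.ne_zero S)) 𝒰 h𝒰K s hint₁ hint₂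
    rw [h𝒰card, cpow_normAbs_det_gjShift_inv hϖq hϖu.ne_zero S s,
      gjLocalZeta_heckeOperator_basis ρ μ hϖu.ne_zero _ b Φ ψ s hint₁ i] at hF1
    have e1 : gjLocalZeta μ (fun X => ∑ γ ∈ 𝒰, Φ (X * ((γ * (gjShift hϖu.ne_zero S)⁻¹ : GL (Fin n) F) :
        Matrix (Fin n) (Fin n) F))) (ρ.matrixCoeff ψ ((b i : ρ.fixedPoints (congruenceGL n (valuation F ϖ ^ m))) : V)) s =
        gjLocalZeta μ Φ' (ρ.matrixCoeff ψ ((b i : ρ.fixedPoints (congruenceGL n (valuation F ϖ ^ m))) : V)) s := by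
      congr 1; funext X; exact (hΦ'eq X).symm
    rw [e1, ← hA] at hF1
    -- solve for `Z(Φ')`
    have hx : ((q : ℂ) ^ (-s)) ^ d ≠ 0 := pow_ne_zero _ (qpow_ne_zero hq s)
    have hJ : (Nat.card J : ℂ) ≠ 0 := by
      rw [Nat.card_eq_fintype_card, Nat.cast_ne_zero]; exact Fintype.card_ne_zero
    have horbC : ((finite_orbit_congruenceGL hϖu.ne_zero m (gjShift hϖu.ne_zero S)).toFinset.card : ℂ) ≠ 0 :=
      Nat.cast_ne_zero.mpr horb
    rw [hc]
    have e2 : ∑ k, z k s * (((Nat.card J : ℂ) /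
        ((finite_orbit_congruenceGL hϖu.ne_zero m (gjShift hϖu.ne_zero S)).toFinset.card : ℂ)) • A) k i =
        ((Nat.card J : ℂ) / ((finite_orbit_congruenceGL hϖu.ne_zero m (gjShift hϖu.ne_zero S)).toFinset.card : ℂ)) *
          ∑ k, A k i * z k s := by
      rw [Finset.mul_sum]
      refine Finset.sum_congr rfl fun k _ => ?_
      rw [Matrix.smul_apply, smul_eq_mul]; ring
    rw [e2]
    have e3 : gjLocalZeta μ Φ' (ρ.matrixCoeff ψ ((b i : ρ.fixedPoints (congruenceGL n (valuation F ϖ ^ m))) : V)) s =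
        ((finite_orbit_congruenceGL hϖu.ne_zero m (gjShift hϖu.ne_zero S)).toFinset.card : ℂ)⁻¹ *
          ((q : ℂ) ^ (-s)) ^ d *
          (((finite_orbit_congruenceGL hϖu.ne_zero m (gjShift hϖu.ne_zero S)).toFinset.card : ℂ) *
            ((((q : ℂ)) ^ (-s)) ^ d)⁻¹ *
            gjLocalZeta μ Φ' (ρ.matrixCoeff ψ ((b i : ρ.fixedPoints (congruenceGL n (valuation F ϖ ^ m))) : V)) s) := by
      field_simp
    rw [e3, ← hF1, div_eq_mul_inv]
    ring
  -- Step 2: the `y_k` are Laurent times `P'`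
  have hclassΦ : ∀ X X₀ : Matrix (Fin n) (Fin n) F, X ∈ gjClass ϖ m (N + 1) X₀ → Φ X = Φ X₀ :=
    fun X X₀ hX => indicator_one_congr_mem (mem_gjClass_iff_of_mem_gjClass_of_le hϖle (Nat.le_succ N) hX _)
  have hclassΦ' : ∀ X X₀ : Matrix (Fin n) (Fin n) F, X ∈ gjClass ϖ m (N + 1) X₀ → Φ' X = Φ' X₀ :=
    fun X X₀ hX => sum_indicator_shift_eq_of_mem_gjClass hϖu hm _ hX
  set Ψ'' : Matrix (Fin n) (Fin n) F → ℂ := fun X => Φ X - Φ' X with hΨ''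
  have hΨ''class : ∀ X X₀ : Matrix (Fin n) (Fin n) F, X ∈ gjClass ϖ m (N + 1) X₀ → Ψ'' X = Ψ'' X₀ := by
    intro X X₀ hX; simp only [hΨ'', hclassΦ X X₀ hX, hclassΦ' X X₀ hX]
  have hΨ''supp : ∀ X, Ψ'' X ≠ 0 → IsIntegralMatrix X := by
    intro X hX
    by_cases hXC : X ∈ C₁
    · exact fun i j => (Valuation.mem_integer_iff _ _).mpr
        (valBound_one_of_mem_gjClass hϖle (valBound_one_gjPin hϖle S a) hXC i j)
    · exfalso; apply hX
      show Φ X - Φ' X = 0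
      rw [hΦ, hΦ', Set.indicator_of_notMem hXC]
      simp only
      rw [sum_indicator_shift_eq_zero hϖu hm hXC, sub_self]
  obtain ⟨ιY, -, -, hdec⟩ := exists_finset_sum_indicator_gjClass (m := m) (N := N + 1) hϖu hΨ''class hΨ''supp
  have hL : ∀ k, IsLaurentTimes q s₀ P' (y k) := by
    intro k
    -- `y_k = Z(Ψ'')`, a finite sum of class zeta integrals
    have hZΨ : ∀ s : ℂ, s₀ < s.re → y k s = ∑ Y ∈ ιY, Ψ'' Y *
        gjLocalZeta μ ((gjClass ϖ m (N + 1) Y).indicator (1 : Matrix (Fin n) (Fin n) F → ℂ))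
          (ρ.matrixCoeff ψ ((b k : ρ.fixedPoints (congruenceGL n (valuation F ϖ ^ m))) : V)) s := by
      intro s hs
      have h1 : y k s = gjLocalZeta μ Ψ'' (ρ.matrixCoeff ψ ((b k : ρ.fixedPoints (congruenceGL n (valuation F ϖ ^ m))) : V)) s := by
        rw [hy, hz, hΨ'']
        exact (gjLocalZeta_sub_left μ Φ Φ' _ s (hint Φ hΦSB ψ hψ _ s hs) (hint Φ' hΦ'SB ψ hψ _ s hs)).symm
      rw [h1]
      have e : gjLocalZeta μ Ψ'' (ρ.matrixCoeff ψ ((b k : ρ.fixedPoints (congruenceGL n (valuation F ϖ ^ m))) : V)) s =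
          gjLocalZeta μ (fun X => ∑ Y ∈ ιY, (gjClass ϖ m (N + 1) Y).indicator (fun _ => Ψ'' Y) X)
            (ρ.matrixCoeff ψ ((b k : ρ.fixedPoints (congruenceGL n (valuation F ϖ ^ m))) : V)) s := by
        congr 1; exact funext hdec
      have hconst : ∀ Y, (fun X => (gjClass ϖ m (N + 1) Y).indicator (fun _ => Ψ'' Y) X) =
          Ψ'' Y • (gjClass ϖ m (N + 1) Y).indicator (1 : Matrix (Fin n) (Fin n) F → ℂ) := by
        intro Y; funext X
        by_cases hXY : X ∈ gjClass ϖ m (N + 1) Y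
        · simp [Set.indicator_of_mem hXY]
        · simp [Set.indicator_of_notMem hXY]
      rw [e, gjLocalZeta_sum_left μ ιY (fun Y X => (gjClass ϖ m (N + 1) Y).indicator (fun _ => Ψ'' Y) X) _ s
        (fun Y _ => ?_)]
      · refine Finset.sum_congr rfl fun Y _ => ?_
        exact gjLocalZeta_indicator_const μ (gjClass ϖ m (N + 1) Y) (Ψ'' Y) _ s
      · rw [hconst Y]
        by_cases hYint : ValBound 1 Y
        · exact hint _ (Submodule.smul_mem _ _ (indicator_gjClass_mem_schwartzBruhat hϖu m (N + 1) hYint)) ψ hψ _ s hs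
        · -- a non-integral `Y` has `Ψ'' Y = 0`
          have : Ψ'' Y = 0 := by
            by_contra h
            exact hYint fun i j => (Valuation.mem_integer_iff _ _).mp (hΨ''supp Y h i j)
          have e0 : gjLocalIntegrand (Ψ'' Y • (gjClass ϖ m (N + 1) Y).indicator (1 : Matrix (Fin n) (Fin n) F → ℂ))
              (ρ.matrixCoeff ψ ((b k : ρ.fixedPoints (congruenceGL n (valuation F ϖ ^ m))) : V)) s = fun _ => 0 := by
            funext x; simp [gjLocalIntegrand, this]
          rw [e0]
          exact integrable_zero _ _ _
    refine (IsLaurentTimes.sum hq ιY (fun Y _ => ?_)).congr hZΨ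
    by_cases hY0 : Ψ'' Y = 0
    · refine (IsLaurentTimes.zero (q := q) (s₀ := s₀) P').congr fun s _ => ?_
      rw [hY0, zero_mul]; rfl
    · -- `Y` lies in a class with more pins: the induction hypothesis applies
      have hne : (∑ bJ : J, C₁.indicator (1 : Matrix (Fin n) (Fin n) F → ℂ)
          (Y * ((gjTransv hϖu hm S bJ : GL (Fin n) F) : Matrix (Fin n) (Fin n) F) *
            (((gjShift hϖu.ne_zero S)⁻¹ : GL (Fin n) F) : Matrix (Fin n) (Fin n) F))) -
          C₁.indicator (1 : Matrix (Fin n) (Fin n) F → ℂ) Y ≠ 0 := by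
        intro h
        apply hY0
        show Φ Y - Φ' Y = 0
        rw [hΦ, hΦ', ← neg_sub]
        simp only
        rw [h, neg_zero]
      obtain ⟨-, -, hmore⟩ := exists_morePins_of_sum_indicator_shift_sub_ne_zero hϖu hm hgap hne
      exact (ih Y hmore _ (b k).2 ψ hψ).const_mul _
  -- Step 3: Cayley–Hamilton
  have hz : ∀ i, IsLaurentTimes q s₀ ((1 - (X ^ d : ℂ[X]) • (c • A).map Polynomial.C).det * P') (z i) :=
    isLaurentTimes_of_sub_eq hq (c • A) d (fun s hs i => by
      show z i s - gjLocalZeta μ Φ' _ s = _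
      rw [hshift s hs i]) hL
  -- Step 4: a general `K_m`-fixed vector
  have hw₀eq : w₀ = ∑ i, b.repr ⟨w₀, hw₀⟩ i •
      ((b i : ρ.fixedPoints (congruenceGL n (valuation F ϖ ^ m))) : V) := by
    conv_lhs => rw [show w₀ = ((⟨w₀, hw₀⟩ : ρ.fixedPoints (congruenceGL n (valuation F ϖ ^ m))) : V) from rfl,
      ← b.sum_repr ⟨w₀, hw₀⟩]
    rw [Submodule.coe_sum]
    refine Finset.sum_congr rfl fun i _ => ?_
    rw [Submodule.coe_smul]
  refine (IsLaurentTimes.sum hq Finset.univ (fun i _ => (hz i).const_mul (b.repr ⟨w₀, hw₀⟩ i))).congr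
    fun s hs => ?_
  have e : gjLocalZeta μ Φ (ρ.matrixCoeff ψ w₀) s = gjLocalZeta μ Φ (ρ.matrixCoeff ψ (∑ i, b.repr ⟨w₀, hw₀⟩ i •
      ((b i : ρ.fixedPoints (congruenceGL n (valuation F ϖ ^ m))) : V))) s := by
    conv_lhs => rw [hw₀eq]
  rw [e, gjLocalZeta_matrixCoeff_sum ρ μ _ Φ ψ _ s (fun i _ => hint Φ hΦSB ψ hψ _ s hs)]
  refine Finset.sum_congr rfl fun i _ => ?_
  rw [gjLocalZeta_matrixCoeff_smul]

omit [BorelSpace (GL (Fin n) F)] in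
/-- **Zeta integrals of class functions decompose** into finitely many class zeta integrals, and
Laurent-ness follows from that of the classes in the support. [folklore] -/
theorem isLaurentTimes_classFun (hϖu : IsUniformizingElement ϖ) {s₀ : ℝ} {P : ℂ[X]}
    {ψ : Module.Dual ℂ V} {w : V}
    (hint : ∀ Φ ∈ SchwartzBruhat (Matrix (Fin n) (Fin n) F), ∀ s : ℂ, s₀ < s.re →
      Integrable (gjLocalIntegrand Φ (ρ.matrixCoeff ψ w) s) μ)
    {N : ℕ} {f : Matrix (Fin n) (Fin n) F → ℂ}
    (hclass : ∀ X Y, X ∈ gjClass ϖ m N Y → f X = f Y) (hsupp : ∀ X, f X ≠ 0 → IsIntegralMatrix X)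
    (hL : ∀ Y, IsIntegralMatrix Y → f Y ≠ 0 → IsLaurentTimes (residueFieldCard F) s₀ P
      (fun s => gjLocalZeta μ ((gjClass ϖ m N Y).indicator (1 : Matrix (Fin n) (Fin n) F → ℂ))
        (ρ.matrixCoeff ψ w) s)) :
    IsLaurentTimes (residueFieldCard F) s₀ P (fun s => gjLocalZeta μ f (ρ.matrixCoeff ψ w) s) := by
  classical
  have hq : residueFieldCard F ≠ 0 := residueFieldCard_ne_zero F
  obtain ⟨ιY, hιint, -, hdec⟩ := exists_finset_sum_indicator_gjClass (m := m) (N := N) hϖu hclass hsupp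
  have hconst : ∀ Y, (fun X => (gjClass ϖ m N Y).indicator (fun _ => f Y) X) =
      f Y • (gjClass ϖ m N Y).indicator (1 : Matrix (Fin n) (Fin n) F → ℂ) := by
    intro Y; funext X
    by_cases hXY : X ∈ gjClass ϖ m N Y
    · simp [Set.indicator_of_mem hXY]
    · simp [Set.indicator_of_notMem hXY]
  have hZ : ∀ s : ℂ, s₀ < s.re → gjLocalZeta μ f (ρ.matrixCoeff ψ w) s =
      ∑ Y ∈ ιY, f Y * gjLocalZeta μ ((gjClass ϖ m N Y).indicator (1 : Matrix (Fin n) (Fin n) F → ℂ))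
        (ρ.matrixCoeff ψ w) s := by
    intro s hs
    have e : gjLocalZeta μ f (ρ.matrixCoeff ψ w) s =
        gjLocalZeta μ (fun X => ∑ Y ∈ ιY, (gjClass ϖ m N Y).indicator (fun _ => f Y) X) (ρ.matrixCoeff ψ w) s := by
      congr 1; exact funext hdec
    rw [e, gjLocalZeta_sum_left μ ιY (fun Y X => (gjClass ϖ m N Y).indicator (fun _ => f Y) X) _ s
      (fun Y hY => ?_)]
    · refine Finset.sum_congr rfl fun Y _ => ?_
      exact gjLocalZeta_indicator_const μ (gjClass ϖ m N Y) (f Y) _ s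
    · rw [hconst Y]
      exact hint _ (Submodule.smul_mem _ _ (indicator_gjClass_mem_schwartzBruhat hϖu m N
        (fun i j => (Valuation.mem_integer_iff _ _).mp (hιint Y hY i j)))) s hs
  refine (IsLaurentTimes.sum hq ιY (fun Y hY => ?_)).congr hZ
  by_cases hY0 : f Y = 0
  · refine (IsLaurentTimes.zero (q := residueFieldCard F) (s₀ := s₀) P).congr fun s _ => ?_
    rw [hY0, zero_mul]; rfl
  · exact (hL Y (hιint Y hY) hY0).const_mul _

omit [BorelSpace (GL (Fin n) F)] in
/-- **Fully pinned classes**: on a class modulo `ϖ^N` of a twist of `gjPin ϖ univ a` (`a_i < N`) the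
determinant has constant absolute value `q^{-∑ a_i}`, so the zeta integral is `(q^{-s})^{∑ a_i}` times a
constant — Laurent times any `P`. [folklore] -/
theorem isLaurentTimes_fullPins (hϖq : normAbs F ϖ = ((residueFieldCard F : ℝ≥0))⁻¹) (s₀ : ℝ) (P : ℂ[X])
    {N : ℕ} {a : Fin n → ℕ} (ha : ∀ i, a i < N) {κ κ' : GL (Fin n) F} (hκ : κ ∈ glInt n F)
    (hκ' : κ' ∈ glInt n F) (f : GL (Fin n) F → ℂ) :
    IsLaurentTimes (residueFieldCard F) s₀ P (fun s => gjLocalZeta μ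
      ((gjClass ϖ m N ((κ : Matrix (Fin n) (Fin n) F) * gjPin ϖ Finset.univ a *
        (κ' : Matrix (Fin n) (Fin n) F))).indicator (1 : Matrix (Fin n) (Fin n) F → ℂ)) f s) := by
  have hϖu : IsUniformizingElement ϖ := isUniformizingElement_of_normAbs_eq hϖq
  set C := gjClass ϖ m N ((κ : Matrix (Fin n) (Fin n) F) * gjPin ϖ Finset.univ a *
    (κ' : Matrix (Fin n) (Fin n) F)) with hC
  set I : ℂ := ∫ x, C.indicator (1 : Matrix (Fin n) (Fin n) F → ℂ) (x : Matrix (Fin n) (Fin n) F) * f x ∂μ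
  refine ⟨Polynomial.C I * X ^ (∑ i, a i) * P, 0, fun s _ => ?_⟩
  have hcpow : ∀ x : GL (Fin n) F, (x : Matrix (Fin n) (Fin n) F) ∈ C →
      (((normAbs F ((Matrix.GeneralLinearGroup.det x : Fˣ) : F) : ℝ≥0) : ℝ) : ℂ) ^ s =
        ((residueFieldCard F : ℂ) ^ (-s)) ^ (∑ i, a i) := by
    intro x hx
    have hv := valuation_det_of_mem_gjClass_gjPin_univ hϖu hκ hκ' ha hx
    rw [Matrix.GeneralLinearGroup.val_det_apply, normAbs_congr (y := ϖ ^ (∑ i, a i)) (by rw [hv, map_pow]),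
      map_pow]
    exact cpow_normAbs_pow hϖq _ s
  beta_reduce
  rw [gjLocalZeta_indicator_of_cpow_eq μ C f s _ hcpow, pow_zero, div_one, Polynomial.eval_mul,
    Polynomial.eval_mul, Polynomial.eval_C, Polynomial.eval_pow, Polynomial.eval_X]
  ring

omit [Field F] [ValuativeRel F] [TopologicalSpace F] [IsNonarchimedeanLocalField F] in
/-- Pinned matrices only depend on the exponents at the pins. [folklore] -/
theorem gjPin_congr [Field F] {S : Finset (Fin n)} {a a' : Fin n → ℕ} (h : ∀ i ∈ S, a' i = a i) :
    gjPin ϖ S a' = gjPin ϖ S a := by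
  unfold gjPin
  congr 1
  funext i
  by_cases hi : i ∈ S
  · rw [if_pos hi, if_pos hi, h i hi]
  · rw [if_neg hi, if_neg hi]

/-- **The induction claim at rank `c`**: the zeta integrals of the indicator functions of the classes
modulo `ϖ^N` of all twisted pinned matrices with at least `c` pins (exponents `< N`), against the
coefficients `⟨ρ(·) w, ψ⟩`, `w ∈ V^{K_m}`, `ψ ∈ Ψ`, are Laurent times `P`. [folklore] -/
def GJClaim (ϖ : F) (m : ℕ) (Ψ : Set (Module.Dual ℂ V)) (s₀ : ℝ) (P : ℂ[X]) (c : ℕ) : Prop :=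
  ∀ (N : ℕ) (κ κ' : GL (Fin n) F), κ ∈ glInt n F → κ' ∈ glInt n F →
    ∀ (S : Finset (Fin n)) (a : Fin n → ℕ), c ≤ S.card → (∀ i ∈ S, a i < N) →
      ∀ w ∈ ρ.fixedPoints (congruenceGL n (valuation F ϖ ^ m)), ∀ ψ ∈ Ψ,
        IsLaurentTimes (residueFieldCard F) s₀ P (fun s => gjLocalZeta μ
          ((gjClass ϖ m N ((κ : Matrix (Fin n) (Fin n) F) * gjPin ϖ S a *
            (κ' : Matrix (Fin n) (Fin n) F))).indicator (1 : Matrix (Fin n) (Fin n) F → ℂ))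
          (ρ.matrixCoeff ψ w) s)

omit [BorelSpace (GL (Fin n) F)] in
/-- Weakening the polynomial in the claim. [folklore] -/
theorem GJClaim.mul_poly {Ψ : Set (Module.Dual ℂ V)} {s₀ : ℝ} {P : ℂ[X]} {c : ℕ}
    (h : GJClaim ρ μ ϖ m Ψ s₀ P c) (E : ℂ[X]) : GJClaim ρ μ ϖ m Ψ s₀ (P * E) c :=
  fun N κ κ' hκ hκ' S a hc ha w hw ψ hψ => (h N κ κ' hκ hκ' S a hc ha w hw ψ hψ).mul_poly E

/-- **The induction step.** Assume the claim at all ranks `c' > c` (for polynomials `P c'` dividing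
`P c`), and that `P (#S)` is divisible by `q_S · P (#S + 1)` for every `S ≠ univ`, `q_S` the
Cayley–Hamilton polynomial of the shift at `S`. Then the claim holds at rank `c`: classes with more
than `c` pins are covered by the hypothesis; a class with exactly `c = n` pins is fully pinned
(`isLaurentTimes_fullPins`); a class with `c < n` pins is untwisted
(`isLaurentTimes_indicator_gjClass_twist`), refined to precision `N + m`
(`exists_mem_gjClass_add_twist`, the pieces with new pins being covered by the hypothesis), untwisted
again, and then handled by the gap atom (`isLaurentTimes_gapAtom`). [folklore] -/
theorem gjClaim_step [μ.IsMulLeftInvariant] [μ.IsMulRightInvariant]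
    (hϖq : normAbs F ϖ = ((residueFieldCard F : ℝ≥0))⁻¹) (hm : 1 ≤ m)
    (Ψ : Set (Module.Dual ℂ V)) (hΨ0 : ∀ ψ ∈ Ψ, ∀ κ ∈ glInt n F, ψ ∘ₗ ρ κ ∈ Ψ)
    (s₀ : ℝ) (hint : ∀ Φ ∈ SchwartzBruhat (Matrix (Fin n) (Fin n) F), ∀ ψ ∈ Ψ, ∀ u : V, ∀ s : ℂ,
      s₀ < s.re → Integrable (gjLocalIntegrand Φ (ρ.matrixCoeff ψ u) s) μ)
    {ι : Type*} [Fintype ι] [DecidableEq ι]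
    (b : Module.Basis ι ℂ (ρ.fixedPoints (congruenceGL n (valuation F ϖ ^ m))))
    (P : ℕ → ℂ[X]) (hPmono : ∀ c c', c ≤ c' → ∃ E, P c = P c' * E)
    (hPdiv : ∀ S : Finset (Fin n), S ≠ Finset.univ → ∃ E, P S.card =
      (1 - (X ^ (n - S.card) : ℂ[X]) •
        ((((Nat.card ({i : Fin n // i ∈ S} × {j : Fin n // j ∉ S} → 𝓀[F]) : ℂ) /
          ((finite_orbit_congruenceGL (isUniformizingElement_of_normAbs_eq hϖq).ne_zero m
            (gjShift (isUniformizingElement_of_normAbs_eq hϖq).ne_zero S)).toFinset.card : ℂ)) •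
          LinearMap.toMatrix b b ((heckeOperator ρ (congruenceGL n (valuation F ϖ ^ m))
            (gjShift (isUniformizingElement_of_normAbs_eq hϖq).ne_zero S)).restrict
            (heckeOperator_mapsTo_fixedPoints ρ (isUniformizingElement_of_normAbs_eq hϖq).ne_zero _))).map Polynomial.C)).det * P (S.card + 1) * E)
    (c : ℕ) (ih : ∀ c', c < c' → GJClaim ρ μ ϖ m Ψ s₀ (P c') c') :
    GJClaim ρ μ ϖ m Ψ s₀ (P c) c := by
  classical
  have hϖu : IsUniformizingElement ϖ := isUniformizingElement_of_normAbs_eq hϖq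
  have hϖle : valuation F ϖ ≤ 1 := hϖu.valuation_le_one
  -- classes with more than `c` pins
  have hmore : ∀ c', c < c' → GJClaim ρ μ ϖ m Ψ s₀ (P c) c' := by
    intro c' hc'
    obtain ⟨E, hE⟩ := hPmono c c' hc'.le
    rw [hE]
    exact GJClaim.mul_poly ρ μ (ih c' hc') E
  intro N κ κ' hκ hκ' S a hcS ha
  rcases hcS.lt_or_eq with hlt | hceq
  · exact hmore _ hlt N κ κ' hκ hκ' S a le_rfl ha
  -- exactly `c` pins
  by_cases hSuniv : S = Finset.univ
  · subst hSuniv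
    intro w _ ψ _
    exact isLaurentTimes_fullPins μ hϖq s₀ (P c) (fun i => ha i (Finset.mem_univ i)) hκ hκ' _
  refine isLaurentTimes_indicator_gjClass_twist ρ μ Ψ hΨ0 ?_ hκ hκ'
  -- untwisted class with pins `S`, `#S = c < n`: refine to precision `N + m`
  intro w hw ψ hψ
  refine isLaurentTimes_classFun ρ μ hϖu (fun Φ hΦ s hs => hint Φ hΦ ψ hψ w s hs) (N := N + m)
    (f := (gjClass ϖ m N (gjPin ϖ S a)).indicator (1 : Matrix (Fin n) (Fin n) F → ℂ))
    (fun X Y hXY => indicator_one_congr_mem (mem_gjClass_iff_of_mem_gjClass_of_le hϖle (Nat.le_add_right N m) hXY _))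
    (fun X hX => ?_) (fun Y hYint hY => ?_)
  · by_contra hXint
    apply hX
    rw [Set.indicator_of_notMem]
    intro hXC
    exact hXint fun i j => (Valuation.mem_integer_iff _ _).mpr
      (valBound_one_of_mem_gjClass hϖle (valBound_one_gjPin hϖle S a) hXC i j)
  -- a piece `gjClass ϖ m (N + m) Y` with `Y ∈ gjClass ϖ m N (gjPin ϖ S a)`
  have hYC : Y ∈ gjClass ϖ m N (gjPin ϖ S a) := by
    by_contra h; exact hY (Set.indicator_of_notMem h _)
  obtain ⟨κ₁, κ₁', hκ₁, hκ₁', T, hTS, a', ha'S, ha'lt, hmem⟩ := exists_mem_gjClass_add_twist hϖu hYC ha m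
  rw [gjClass_eq_of_mem hmem]
  by_cases hT : T.Nonempty
  · -- new pins: the induction hypothesis
    have hcard : c < (S ∪ T).card := by
      rw [hceq]
      obtain ⟨i, hi⟩ := hT
      exact Finset.card_lt_card ⟨Finset.subset_union_left, fun h => hTS i hi (h (Finset.mem_union_right _ hi))⟩
    exact hmore _ hcard (N + m) κ₁ κ₁' hκ₁ hκ₁' (S ∪ T) a' le_rfl ha'lt w hw ψ hψ
  · -- no new pins: untwist again and apply the gap atom
    rw [Finset.not_nonempty_iff_eq_empty] at hT
    subst hT
    rw [Finset.union_empty] at ha'lt ⊢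
    rw [gjPin_congr ha'S]
    revert w hw ψ hψ
    refine isLaurentTimes_indicator_gjClass_twist ρ μ Ψ hΨ0 ?_ hκ₁ hκ₁'
    have hgap : ∀ i ∈ S, a i + m ≤ N + m := fun i hi => Nat.add_le_add_right (ha i hi).le m
    obtain ⟨E, hE⟩ := hPdiv S hSuniv
    rw [hceq, hE]
    intro w hw ψ hψ
    refine (isLaurentTimes_gapAtom ρ μ hϖq hm Ψ s₀ hint b hgap rfl rfl (P' := P (S.card + 1)) ?_ w hw ψ hψ).mul_poly E
    -- the gap atom's hypothesis: classes with new pins at precision `N + m + 1`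
    rintro Y' ⟨κ₂, κ₂', hκ₂, hκ₂', T', hT'ne, hT'S, hmem'⟩
    rw [gjClass_eq_of_mem hmem']
    have hcard : S.card < (S ∪ T').card := by
      obtain ⟨i, hi⟩ := hT'ne
      exact Finset.card_lt_card ⟨Finset.subset_union_left, fun h => hT'S i hi (h (Finset.mem_union_right _ hi))⟩
    intro w hw ψ hψ
    have h1 := ih (S.card + 1) (by omega) (N + m + 1) κ₂ κ₂' hκ₂ hκ₂' (S ∪ T')
      (fun i => if i ∈ S then a i else N + m) hcard (fun i hi => ?_) w hw ψ hψ
    · exact h1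
    · by_cases hiS : i ∈ S
      · rw [if_pos hiS]; have := ha i hiS; omega
      · rw [if_neg hiS]; exact Nat.lt_succ_self _

/-- **The claim at every rank**, by downward induction from the vacuous ranks `c > n`. [folklore] -/
theorem gjClaim_all [μ.IsMulLeftInvariant] [μ.IsMulRightInvariant]
    (hϖq : normAbs F ϖ = ((residueFieldCard F : ℝ≥0))⁻¹) (hm : 1 ≤ m)
    (Ψ : Set (Module.Dual ℂ V)) (hΨ0 : ∀ ψ ∈ Ψ, ∀ κ ∈ glInt n F, ψ ∘ₗ ρ κ ∈ Ψ)
    (s₀ : ℝ) (hint : ∀ Φ ∈ SchwartzBruhat (Matrix (Fin n) (Fin n) F), ∀ ψ ∈ Ψ, ∀ u : V, ∀ s : ℂ,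
      s₀ < s.re → Integrable (gjLocalIntegrand Φ (ρ.matrixCoeff ψ u) s) μ)
    {ι : Type*} [Fintype ι] [DecidableEq ι]
    (b : Module.Basis ι ℂ (ρ.fixedPoints (congruenceGL n (valuation F ϖ ^ m))))
    (P : ℕ → ℂ[X]) (hPmono : ∀ c c', c ≤ c' → ∃ E, P c = P c' * E)
    (hPdiv : ∀ S : Finset (Fin n), S ≠ Finset.univ → ∃ E, P S.card =
      (1 - (X ^ (n - S.card) : ℂ[X]) •
        ((((Nat.card ({i : Fin n // i ∈ S} × {j : Fin n // j ∉ S} → 𝓀[F]) : ℂ) /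
          ((finite_orbit_congruenceGL (isUniformizingElement_of_normAbs_eq hϖq).ne_zero m
            (gjShift (isUniformizingElement_of_normAbs_eq hϖq).ne_zero S)).toFinset.card : ℂ)) •
          LinearMap.toMatrix b b ((heckeOperator ρ (congruenceGL n (valuation F ϖ ^ m))
            (gjShift (isUniformizingElement_of_normAbs_eq hϖq).ne_zero S)).restrict
            (heckeOperator_mapsTo_fixedPoints ρ (isUniformizingElement_of_normAbs_eq hϖq).ne_zero _))).map
          Polynomial.C)).det * P (S.card + 1) * E)
    (c : ℕ) : GJClaim ρ μ ϖ m Ψ s₀ (P c) c := by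
  suffices h : ∀ j c, n < c + j → GJClaim ρ μ ϖ m Ψ s₀ (P c) c from h (n + 1) c (by omega)
  intro j
  induction j with
  | zero =>
    intro c hc N κ κ' _ _ S a hcS _
    exfalso
    have h1 : S.card ≤ n := (Finset.card_le_univ S).trans_eq (Fintype.card_fin n)
    omega
  | succ j ihj =>
    intro c hc
    exact gjClaim_step ρ μ hϖq hm Ψ hΨ0 s₀ hint b P hPmono hPdiv c fun c' hc' => ihj c' (by omega)

/-- **Rationality with a common denominator at a fixed level (Godement–Jacquet (1972), Thm. 3.3 (2),
level-`K_m` form).** Let `|ϖ| = q⁻¹`, `m ≥ 1`, `μ` a bi-invariant measure on `GL_n(F)`, `ρ` a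
representation with `V^{K_m}` finite-dimensional, `Ψ` a `GL_n(𝒪)`-stable family of linear forms, and
`s₀` a common abscissa of absolute convergence of the zeta integrals `Z(Φ, s, ⟨ρ(·) u, ψ⟩)`
(`Φ` Schwartz–Bruhat, `ψ ∈ Ψ`). Then there is ONE polynomial `P₀` with `P₀(0) = 1` such that for every
function `f` on `M_n(F)` constant on the classes `K_m (Y + ϖ^N M_n(𝒪)) K_m` (any `N`) and vanishing off
`M_n(𝒪)`, every `w ∈ V^{K_m}` and every `ψ ∈ Ψ`, `P₀(q^{-s}) Z(f, s, ⟨ρ(·) w, ψ⟩)` is a Laurent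
polynomial in `q^{-s}` on `re s > s₀`. `P₀` is the product over the proper pin sets `S ⊊ {1,…,n}` of the
Cayley–Hamilton polynomials `det(1 - T^{n-#S} c_S A_S)` of the Hecke shifts `[K_m diag(1_S, ϖ) K_m]`
on `V^{K_m}`. [cite: GodementJacquet1972, Thm. 3.3 (2)] -/
theorem exists_poly_isLaurentTimes_classFun [μ.IsMulLeftInvariant] [μ.IsMulRightInvariant]
    (hϖq : normAbs F ϖ = ((residueFieldCard F : ℝ≥0))⁻¹) (hm : 1 ≤ m)
    [Module.Finite ℂ (ρ.fixedPoints (congruenceGL n (valuation F ϖ ^ m)))]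
    (Ψ : Set (Module.Dual ℂ V)) (hΨ0 : ∀ ψ ∈ Ψ, ∀ κ ∈ glInt n F, ψ ∘ₗ ρ κ ∈ Ψ)
    (s₀ : ℝ) (hint : ∀ Φ ∈ SchwartzBruhat (Matrix (Fin n) (Fin n) F), ∀ ψ ∈ Ψ, ∀ u : V, ∀ s : ℂ,
      s₀ < s.re → Integrable (gjLocalIntegrand Φ (ρ.matrixCoeff ψ u) s) μ) :
    ∃ P₀ : ℂ[X], P₀.eval 0 = 1 ∧
      ∀ (N : ℕ) (f : Matrix (Fin n) (Fin n) F → ℂ), (∀ X Y, X ∈ gjClass ϖ m N Y → f X = f Y) →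
        (∀ X, f X ≠ 0 → IsIntegralMatrix X) →
        ∀ w ∈ ρ.fixedPoints (congruenceGL n (valuation F ϖ ^ m)), ∀ ψ ∈ Ψ,
          IsLaurentTimes (residueFieldCard F) s₀ P₀ (fun s => gjLocalZeta μ f (ρ.matrixCoeff ψ w) s) := by
  classical
  have hϖu : IsUniformizingElement ϖ := isUniformizingElement_of_normAbs_eq hϖq
  set b := Module.finBasis ℂ (ρ.fixedPoints (congruenceGL n (valuation F ϖ ^ m))) with hb
  -- the Cayley–Hamilton polynomials of the shifts and their products
  set qS : Finset (Fin n) → ℂ[X] := fun S =>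
    (1 - (X ^ (n - S.card) : ℂ[X]) •
      ((((Nat.card ({i : Fin n // i ∈ S} × {j : Fin n // j ∉ S} → 𝓀[F]) : ℂ) /
        ((finite_orbit_congruenceGL hϖu.ne_zero m (gjShift hϖu.ne_zero S)).toFinset.card : ℂ)) •
        LinearMap.toMatrix b b ((heckeOperator ρ (congruenceGL n (valuation F ϖ ^ m))
          (gjShift hϖu.ne_zero S)).restrict (heckeOperator_mapsTo_fixedPoints ρ hϖu.ne_zero _))).map
        Polynomial.C)).det with hqS
  set 𝔖 : ℕ → Finset (Finset (Fin n)) := fun c =>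
    (Finset.univ : Finset (Finset (Fin n))).filter fun S => S ≠ Finset.univ ∧ c ≤ S.card with h𝔖
  set P : ℕ → ℂ[X] := fun c => ∏ S ∈ 𝔖 c, qS S with hP
  have h𝔖mono : ∀ c c', c ≤ c' → 𝔖 c' ⊆ 𝔖 c := by
    intro c c' hcc' S hS
    simp only [h𝔖, Finset.mem_filter, Finset.mem_univ, true_and] at hS ⊢
    exact ⟨hS.1, hcc'.trans hS.2⟩
  have hPmono : ∀ c c', c ≤ c' → ∃ E, P c = P c' * E := by
    intro c c' hcc'
    refine ⟨∏ S ∈ 𝔖 c \ 𝔖 c', qS S, ?_⟩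
    rw [hP]
    simp only
    rw [mul_comm, Finset.prod_sdiff (h𝔖mono c c' hcc')]
  have hPdiv : ∀ S : Finset (Fin n), S ≠ Finset.univ → ∃ E, P S.card = qS S * P (S.card + 1) * E := by
    intro S hS
    have hSmem : S ∈ 𝔖 S.card := by
      simp only [h𝔖, Finset.mem_filter, Finset.mem_univ, true_and]; exact ⟨hS, le_rfl⟩
    have hsub : 𝔖 (S.card + 1) ⊆ (𝔖 S.card).erase S := by
      intro S' hS'
      simp only [h𝔖, Finset.mem_filter, Finset.mem_univ, true_and, Finset.mem_erase] at hS' ⊢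
      refine ⟨fun h => ?_, hS'.1, (Nat.le_succ _).trans hS'.2⟩
      rw [h] at hS'; omega
    refine ⟨∏ S' ∈ (𝔖 S.card).erase S \ 𝔖 (S.card + 1), qS S', ?_⟩
    rw [hP]
    simp only
    rw [← Finset.mul_prod_erase _ _ hSmem, ← Finset.prod_sdiff hsub, mul_assoc, mul_comm (∏ S' ∈ 𝔖 (S.card + 1), qS S')]
  have heval : (P 0).eval 0 = 1 := by
    rw [hP]
    simp only
    rw [Polynomial.eval_prod]
    refine Finset.prod_eq_one fun S hS => ?_
    simp only [h𝔖, Finset.mem_filter, Finset.mem_univ, true_and] at hS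
    refine eval_zero_det_one_sub_X_pow_smul _ (Nat.sub_ne_zero_of_lt ?_)
    exact (Finset.card_lt_iff_ne_univ _).mpr hS.1 |>.trans_eq (Fintype.card_fin n)
  refine ⟨P 0, heval, fun N f hclass hsupp w hw ψ hψ => ?_⟩
  have hall := gjClaim_all ρ μ hϖq hm Ψ hΨ0 s₀ hint b P hPmono (fun S hS => hPdiv S hS) 0
  refine isLaurentTimes_classFun ρ μ hϖu (fun Φ hΦ s hs => hint Φ hΦ ψ hψ w s hs) hclass hsupp
    fun Y hYint _ => ?_
  obtain ⟨κ, κ', hκ, hκ', S, a, ha, hmem⟩ := exists_mem_gjClass_twist_gjPin hϖu m N hYint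
  rw [gjClass_eq_of_mem hmem]
  exact hall N κ κ' hκ hκ' S a (Nat.zero_le _) ha w hw ψ hψ

end Level

end Literature.NumberTheory.Automorphic
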